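import Literature.NumberTheory.ComplexMultiplication.CMAlgebraLatticeKernelUnitIndex
import HarnessLib

/-!
# `[Λ_1^{unit} : Λ_2^{unit}] < ∞` and the FINITENESS of `(Λ_1/C)^{unit}/(Λ_2/C)^{unit}` and of
# `ker(G(Λ_2) → G(Λ_1))` for orders `Λ_2 ⊆ Λ_1` of a CM-ALGEBRA `Y = L_1 ⊕ ⋯ ⊕ L_t`
# (Hertling–Larabi 2026 Thm. 8.2 (f): «the group Λ_2^{unit} has finite index in the group Λ_1^{unit}»)

[node N13c] [stratum S1] [book HertlingLarabi2026 > §8 Exact sequences for an order and a smaller order > Thm. 8.2 (c), (f)]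

Topic `Literature/NumberTheory/ComplexMultiplication`, namespace `Literature.NumberTheory.ComplexMultiplication`;
lane `lit-hodgefound` (Track 2 foundations library), Layer A3, seat p19 generation 32, row g32-#9 — sequel of
g32-#8 (`CMAlgebraLatticeKernelUnitIndex`: the class number formula
`#G([Λ_2]_ε)·[Λ_1^{unit} : Λ_2^{unit}] = #G([Λ_1]_ε)·#((Λ_1/C)^{unit}/(Λ_2/C)^{unit})` with `Nat.card`s).  Here the
`Nat.card`s are shown to be honest cardinalities: `(Λ_1/C)^{unit}/(Λ_2/C)^{unit}` is finite (a quotient of a subset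
of the finite group `Λ_1/C`, window finiteness), hence so is the lattice kernel, and — reading the formula —
`[Λ_1^{unit} : Λ_2^{unit}] ≠ 0`.  THEOREMS ONLY: no definition, no instance, no named fact (D-0026, net Literature
debt `0`), no `sorry`.

## Source, VERBATIM

C. Hertling, K. Larabi, *Semigroups from full lattices in commutative ℚ-algebras*, arXiv:2602.14973 (2026)
[HertlingLarabi2026], held `paper:arxiv-2602.14973`.  §8 (chunks p0021–p0023): «**Theorem 8.2.** […] (c) There is
a natural isomorphism of groups `(Λ_1/C)^{unit}/(Λ_2/C)^{unit} → ⊕_{p∈P_0}(Λ_1)_(p)^{unit}/(Λ_2)_(p)^{unit}`. […]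
(f) The group `Λ_2^{unit}` has finite index in the group `Λ_1^{unit}`. By Theorem 6.5 the groups `G([Λ_2]_ε)`
and `G([Λ_1]_ε)` are finite. The size of one of them can be calculated by the size of the other one with the
following formula (8.10). *Proof:* […] (f) The left hand side of the isomorphism in part (c) is obviously finite.
One applies the exact sequence in part (e) and the isomorphism in part (c). Especially, the group `Λ_2^{unit}`
has finite index in the group `Λ_1^{unit}`.»

## References

* [HL26] C. Hertling, K. Larabi, *Semigroups from full lattices in commutative ℚ-algebras*, arXiv:2602.14973
  (2026), §8 Thm. 8.2 (c), (f) (chunks p0021–p0023). [cite: HertlingLarabi2026]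
* [Ne99] J. Neukirch, *Algebraic Number Theory*, Grundlehren 322 (1999), I §12 Thm. (12.12) (one field), as
  identified by [HL26] Rem. 8.3. [cite: NeukirchANT1999]
-/

noncomputable section

open scoped Classical Pointwise nonZeroDivisors NumberField
open Module NumberField Function

namespace Literature.NumberTheory.ComplexMultiplication

open Literature.NumberTheory.Automorphic

section UnitIndexFinite

variable {t : Type} {L : t → Type} [∀ i, Field (L i)] [∀ i, NumberField (L i)]

/-- **«The left hand side of the isomorphism in part (c) is obviously finite»: `(Λ_1/C)^{unit}/(Λ_2/C)^{unit}` is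
FINITE** for full lattices `Λ_1, Λ_2` with `1 ∈ Λ_2`, `C = Λ_2:Λ_1` — two members of
`{a ∈ Λ_1 | a + C ∈ (Λ_1/C)^{unit}}` with the same residue in the finite group `Λ_1/C` (`C ⊇ nΛ_1`, `n ≠ 0`: window
finiteness `relIndex_ne_zero_of_smul_mem`) are equivalent (`v = 1`), so the quotient is an image of a subset of
`Λ_1/C`. [cite: HertlingLarabi2026, §8 Thm. 8.2 (f) proof («The left hand side of the isomorphism in part (c) is obviously finite»), chunk p0023] -/
theorem finite_quot_unitsModConductor {Λ₁ Λ₂ : Submodule ℤ (Π i, L i)} (hΛ₁ : IsFullLattice (Π i, L i) Λ₁)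
    (hΛ₂ : IsFullLattice (Π i, L i) Λ₂) (h2 : (1 : Π i, L i) ∈ Λ₂) :
    Finite (Quot (fun a b : {a : Π i, L i // a ∈ Λ₁ ∧ ∃ a' ∈ Λ₁, a * a' - 1 ∈ Λ₂ / Λ₁} =>
      ∃ v ∈ Λ₂, (∃ v' ∈ Λ₂, v * v' - 1 ∈ Λ₂ / Λ₁) ∧ (b : Π i, L i) - a * v ∈ Λ₂ / Λ₁)) := by
  classical
  -- `Λ₁/C` is finite
  obtain ⟨n, hn, hnC⟩ := exists_smul_mem_of_fg (isFullLattice_div hΛ₂ hΛ₁) hΛ₁.1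
  have hidx := relIndex_ne_zero_of_smul_mem Λ₁ hΛ₁.1 hn (Λ₂ / Λ₁) hnC
  rw [AddSubgroup.relIndex, AddSubgroup.index] at hidx
  haveI hF := Nat.finite_of_card_ne_zero hidx
  -- the residue map, and: equal residues give equal classes (`v = 1`)
  let res : {a : Π i, L i // a ∈ Λ₁ ∧ ∃ a' ∈ Λ₁, a * a' - 1 ∈ Λ₂ / Λ₁} →
      Λ₁.toAddSubgroup ⧸ (Λ₂ / Λ₁).toAddSubgroup.addSubgroupOf Λ₁.toAddSubgroup :=
    fun a => QuotientAddGroup.mk ⟨(a : Π i, L i), a.2.1⟩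
  have hres : ∀ a b : {a : Π i, L i // a ∈ Λ₁ ∧ ∃ a' ∈ Λ₁, a * a' - 1 ∈ Λ₂ / Λ₁}, res a = res b →
      Quot.mk (fun a b : {a : Π i, L i // a ∈ Λ₁ ∧ ∃ a' ∈ Λ₁, a * a' - 1 ∈ Λ₂ / Λ₁} =>
        ∃ v ∈ Λ₂, (∃ v' ∈ Λ₂, v * v' - 1 ∈ Λ₂ / Λ₁) ∧ (b : Π i, L i) - a * v ∈ Λ₂ / Λ₁) a = Quot.mk _ b := by
    intro a b hab
    have h := (QuotientAddGroup.eq).1 hab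
    rw [AddSubgroup.mem_addSubgroupOf] at h
    have h' : -(a : Π i, L i) + b ∈ Λ₂ / Λ₁ := by simpa using h
    refine Quot.sound ⟨1, h2, ⟨1, h2, by rw [mul_one, sub_self]; exact (Λ₂ / Λ₁).zero_mem⟩, ?_⟩
    have e : (b : Π i, L i) - a * 1 = -(a : Π i, L i) + b := by ring
    rw [e]
    exact h'
  -- the quotient is the image of a subset of the finite `Λ₁/C`
  refine Finite.of_surjective
    (fun x : {x : Λ₁.toAddSubgroup ⧸ (Λ₂ / Λ₁).toAddSubgroup.addSubgroupOf Λ₁.toAddSubgroup //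
        ∃ a : {a : Π i, L i // a ∈ Λ₁ ∧ ∃ a' ∈ Λ₁, a * a' - 1 ∈ Λ₂ / Λ₁}, res a = x} =>
      Quot.mk _ x.2.choose) fun q => ?_
  induction q using Quot.ind with | mk a => ?_
  refine ⟨⟨res a, a, rfl⟩, ?_⟩
  have hc : res (Exists.choose (⟨a, rfl⟩ : ∃ a' : {a : Π i, L i // a ∈ Λ₁ ∧ ∃ a' ∈ Λ₁, a * a' - 1 ∈ Λ₂ / Λ₁},
      res a' = res a)) = res a := Exists.choose_spec (⟨a, rfl⟩ : ∃ a', res a' = res a)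
  exact hres _ _ hc

/-- `(Λ_1/C)^{unit}/(Λ_2/C)^{unit}` has nonzero (finite) cardinality. [cite: HertlingLarabi2026, §8 Thm. 8.2 (f) proof, chunk p0023] -/
theorem natCard_quot_unitsModConductor_ne_zero {Λ₁ Λ₂ : Submodule ℤ (Π i, L i)}
    (hΛ₁ : IsFullLattice (Π i, L i) Λ₁) (h1 : (1 : Π i, L i) ∈ Λ₁) (hΛ₂ : IsFullLattice (Π i, L i) Λ₂)
    (h2 : (1 : Π i, L i) ∈ Λ₂) :
    Nat.card (Quot (fun a b : {a : Π i, L i // a ∈ Λ₁ ∧ ∃ a' ∈ Λ₁, a * a' - 1 ∈ Λ₂ / Λ₁} =>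
      ∃ v ∈ Λ₂, (∃ v' ∈ Λ₂, v * v' - 1 ∈ Λ₂ / Λ₁) ∧ (b : Π i, L i) - a * v ∈ Λ₂ / Λ₁)) ≠ 0 := by
  haveI := finite_quot_unitsModConductor hΛ₁ hΛ₂ h2
  exact Nat.card_ne_zero.2
    ⟨⟨Quot.mk _ ⟨1, h1, 1, h1, by rw [mul_one, sub_self]; exact (Λ₂ / Λ₁).zero_mem⟩⟩, inferInstance⟩

/-- `#G([Λ]_ε) ≠ 0`: the Picard set of an order is finite (Thm. 6.5, g32-#1) and contains `[Λ]_ε`.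
[cite: HertlingLarabi2026, §6 Thm. 6.5 and §8 Thm. 8.2 (f) («the groups G([Λ_2]_ε) and G([Λ_1]_ε) are finite»), chunks p0015, p0021] -/
theorem natCard_quot_pic_ne_zero [Fintype t] {Λ : Submodule ℤ (Π i, L i)} (hΛ : IsFullLattice (Π i, L i) Λ)
    (h1 : (1 : Π i, L i) ∈ Λ) (hΛΛ : Λ * Λ ≤ Λ) :
    Nat.card (Quot (fun M M' : {M : Submodule ℤ (Π i, L i) //
        (IsFullLattice (Π i, L i) M ∧ M / M = Λ) ∧ M * ((M / M) / M) = M / M} =>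
      ∃ u : (Π i, L i)ˣ, u • (M : Submodule ℤ (Π i, L i)) = M')) ≠ 0 := by
  haveI := finite_quot_pic_div_self_eq (L := L) Λ
  exact Nat.card_ne_zero.2
    ⟨⟨Quot.mk _ ⟨Λ, ⟨hΛ, div_self_eq_of_one_mem h1 hΛΛ⟩, mul_div_div_eq_of_one_mem h1 hΛΛ⟩⟩, inferInstance⟩

/-- **THEOREM 8.2 (f): «the group `Λ_2^{unit}` has finite index in the group `Λ_1^{unit}`»** for orders
`Λ_2 ⊆ Λ_1` of `Y` — read off the class number formula (g32-#8 `natCard_quot_pic_mul_relIndex_eq`), whose right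
hand side is nonzero. [cite: HertlingLarabi2026, §8 Thm. 8.2 (f), chunks p0021, p0023]
[cite: NeukirchANT1999, I §12 Thm. (12.12) (one field: [𝒪_K^* : 𝒪^*] < ∞)] -/
theorem relIndex_stabilizer_ne_zero [Fintype t] {Λ₁ Λ₂ : Submodule ℤ (Π i, L i)}
    (hΛ₁ : IsFullLattice (Π i, L i) Λ₁) (h1 : (1 : Π i, L i) ∈ Λ₁) (hΛ₁Λ₁ : Λ₁ * Λ₁ ≤ Λ₁)
    (hΛ₂ : IsFullLattice (Π i, L i) Λ₂) (h2 : (1 : Π i, L i) ∈ Λ₂) (hΛ₂Λ₂ : Λ₂ * Λ₂ ≤ Λ₂) (hle : Λ₂ ≤ Λ₁) :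
    (MulAction.stabilizer (Π i, L i)ˣ Λ₂).relIndex (MulAction.stabilizer (Π i, L i)ˣ Λ₁) ≠ 0 := by
  have h := natCard_quot_pic_mul_relIndex_eq hΛ₁ h1 hΛ₁Λ₁ hΛ₂ h2 hΛ₂Λ₂ hle
  have hr := mul_ne_zero (natCard_quot_pic_ne_zero hΛ₁ h1 hΛ₁Λ₁)
    (natCard_quot_unitsModConductor_ne_zero hΛ₁ h1 hΛ₂ h2)
  rw [← h] at hr
  exact (mul_ne_zero_iff.1 hr).2

/-- **The lattice kernel `ker(G(Λ_2) → G(Λ_1))` is FINITE** (in bijection with the finite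
`(Λ_1/C)^{unit}/(Λ_2/C)^{unit}`, Thm. 8.2 (d)). [cite: HertlingLarabi2026, §8 Thm. 8.2 (c), (d), (f), chunks p0021–p0023] -/
theorem finite_kerLat {Λ₁ Λ₂ : Submodule ℤ (Π i, L i)} (hΛ₁ : IsFullLattice (Π i, L i) Λ₁)
    (h1 : (1 : Π i, L i) ∈ Λ₁) (hΛ₁Λ₁ : Λ₁ * Λ₁ ≤ Λ₁) (hΛ₂ : IsFullLattice (Π i, L i) Λ₂)
    (h2 : (1 : Π i, L i) ∈ Λ₂) (hΛ₂Λ₂ : Λ₂ * Λ₂ ≤ Λ₂) (hle : Λ₂ ≤ Λ₁) :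
    Finite {K : Submodule ℤ (Π i, L i) //
      ((IsFullLattice (Π i, L i) K ∧ K / K = Λ₂) ∧ K * ((K / K) / K) = K / K) ∧ Λ₁ * K = Λ₁} := by
  apply Nat.finite_of_card_ne_zero
  rw [← natCard_quot_unitsModConductor_eq_natCard_kerLat hΛ₁ h1 hΛ₁Λ₁ hΛ₂ h2 hΛ₂Λ₂ hle]
  exact natCard_quot_unitsModConductor_ne_zero hΛ₁ h1 hΛ₂ h2

/-- `#ker(G(Λ_2) → G(Λ_1)) ≠ 0` (the lattice kernel is finite and contains `Λ_2`).
[cite: HertlingLarabi2026, §8 Thm. 8.2 (d), (f), chunks p0022–p0023] -/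
theorem natCard_kerLat_ne_zero {Λ₁ Λ₂ : Submodule ℤ (Π i, L i)} (hΛ₁ : IsFullLattice (Π i, L i) Λ₁)
    (h1 : (1 : Π i, L i) ∈ Λ₁) (hΛ₁Λ₁ : Λ₁ * Λ₁ ≤ Λ₁) (hΛ₂ : IsFullLattice (Π i, L i) Λ₂)
    (h2 : (1 : Π i, L i) ∈ Λ₂) (hΛ₂Λ₂ : Λ₂ * Λ₂ ≤ Λ₂) (hle : Λ₂ ≤ Λ₁) :
    Nat.card {K : Submodule ℤ (Π i, L i) //
      ((IsFullLattice (Π i, L i) K ∧ K / K = Λ₂) ∧ K * ((K / K) / K) = K / K) ∧ Λ₁ * K = Λ₁} ≠ 0 := by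
  rw [← natCard_quot_unitsModConductor_eq_natCard_kerLat hΛ₁ h1 hΛ₁Λ₁ hΛ₂ h2 hΛ₂Λ₂ hle]
  exact natCard_quot_unitsModConductor_ne_zero hΛ₁ h1 hΛ₂ h2

end UnitIndexFinite

end Literature.NumberTheory.ComplexMultiplication
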